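import Summits.Ventures.PercRepro.MSTightBipartitionTrace

/-!
# Projections of a set family: excess, twin-freeness, and the fibres of a two-element projection

Tools for the proof of (SD) — «a family of Marica–Schönheim excess at most one has every
nontrivial twin-free element among its singleton differences» (proofs/MINE1-theoremS.md,
Addendum 20; the theorem itself is `ExcessOneSingleton.lean`).

* `diffs_image_sdiff`: the differences of `{t \ A : t ∈ F}` are `{d \ A : d ∈ F \\ F}`.
* `mem_diffsX_iff`, `mem_diffsY_iff`, `singleton_mem_diffs_proj_iff`: membership in the two
  halves `X`, `Y` of the difference family at `r` (`MSTightProj.lean`), and `{x} ∈ D(proj a F)`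
  iff `{x} ∈ D(F)` or `{a, x} ∈ D(F)`.
* `card_diffs_proj_add_card_partner_le`: the projection along `a` has excess at most the excess
  of `F`; `twin_proj_eq_of_twin_eq`: a twin-free element stays twin-free in the projection.
* The two fibre counts of the projection `t ↦ t \ A` along a pair `A = {r, r'}`:
  `card_le_card_image_sdiff_add_card_diag` (members: two members with the same image form a
  diagonal pair `{v, v ∪ A}`) and `card_image_sdiff_add_card_diffs_diag_add_card_le`
  (differences: the fibre of a difference `e` of the diagonal family contains `e` and `e ∪ A`,
  the fibre of a singleton `{a}` contains `{a, r}` and `{a, r'}`).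
-/

namespace PercRepro.MSTight

open Finset
open scoped FinsetFamily

variable {α : Type*} [DecidableEq α]

section Projection

/-- The differences of the image of `F` under `t ↦ t \ A` are the images of the differences. -/
theorem diffs_image_sdiff (F : Finset (Finset α)) (A : Finset α) :
    (F.image fun t => t \ A) \\ (F.image fun t => t \ A) = (F \\ F).image fun d => d \ A := by
  ext d
  simp only [mem_diffs, mem_image]
  constructor
  · rintro ⟨x, ⟨t, ht, rfl⟩, y, ⟨s, hs, rfl⟩, rfl⟩
    refine ⟨t \ s, ⟨t, ht, s, hs, rfl⟩, ?_⟩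
    ext z
    simp only [mem_sdiff]
    tauto
  · rintro ⟨e, ⟨t, ht, s, hs, rfl⟩, rfl⟩
    refine ⟨t \ A, ⟨t, ht, rfl⟩, s \ A, ⟨s, hs, rfl⟩, ?_⟩
    ext z
    simp only [mem_sdiff]
    tauto

/-- `X` is the set of differences avoiding `r`. -/
theorem mem_diffsX_iff {r : α} {F : Finset (Finset α)} {E : Finset α} :
    E ∈ diffsX r F ↔ E ∈ F \\ F ∧ r ∉ E := by
  rw [← diffs_filter_notMem, mem_filter]

/-- `Y` is the set of differences containing `r`, with `r` removed. -/
theorem mem_diffsY_iff {r : α} {F : Finset (Finset α)} {E : Finset α} :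
    E ∈ diffsY r F ↔ r ∉ E ∧ insert r E ∈ F \\ F := by
  constructor
  · intro h
    refine ⟨notMem_of_mem_diffsY h, ?_⟩
    have h' : insert r E ∈ (F \\ F).filter (fun E => r ∈ E) := by
      rw [diffs_filter_mem]
      exact mem_image_of_mem _ h
    exact (mem_filter.1 h').1
  · rintro ⟨hr, h⟩
    have h' : insert r E ∈ (F \\ F).filter (fun E => r ∈ E) :=
      mem_filter.2 ⟨h, mem_insert_self r E⟩
    rw [diffs_filter_mem, mem_image] at h'
    obtain ⟨E', hE', hEE'⟩ := h'
    have hr' : r ∉ E' := notMem_of_mem_diffsY hE'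
    have hE : E' = E := by
      rw [← erase_insert hr', hEE', erase_insert hr]
    rw [← hE]
    exact hE'

/-- The projection along `a` has excess at most the excess of `F`:
`|proj a F \\ proj a F| + |partner a F| ≤ |F \\ F|`. -/
theorem card_diffs_proj_add_card_partner_le (a : α) (F : Finset (Finset α)) :
    (proj a F \\ proj a F).card + (partner a F).card ≤ (F \\ F).card := by
  have h1 := card_diffs_eq_card_diffs_proj_add a F
  have h2 : (partner a F).card ≤ (partner a F \\ partner a F).card := card_le_card_diffs _
  have h3 : (partner a F \\ partner a F).card ≤ (diffsX a F ∩ diffsY a F).card :=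
    card_le_card (diffs_partner_subset a F)
  omega

/-- For `x ≠ a`, `{x}` is a difference of the projection along `a` iff `{x}` or `{a, x}` is a
difference of `F`. -/
theorem singleton_mem_diffs_proj_iff {a x : α} (hxa : x ≠ a) (F : Finset (Finset α)) :
    ({x} : Finset α) ∈ proj a F \\ proj a F ↔
      ({x} : Finset α) ∈ F \\ F ∨ insert a ({x} : Finset α) ∈ F \\ F := by
  rw [diffs_proj_eq, mem_union, mem_diffsX_iff, mem_diffsY_iff]
  have hax : a ∉ ({x} : Finset α) := by
    rw [mem_singleton]
    exact fun h => hxa h.symm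
  constructor
  · rintro (⟨h, -⟩ | ⟨-, h⟩)
    · exact Or.inl h
    · exact Or.inr h
  · rintro (h | h)
    · exact Or.inl ⟨h, hax⟩
    · exact Or.inr ⟨hax, h⟩

/-- A twin-free element lying in some member stays twin-free in the projection along another
element. -/
theorem twin_proj_eq_of_twin_eq {a x : α} (hxa : x ≠ a) {F : Finset (Finset α)}
    (htw : ∀ b, Twin F x b → b = x) (hin : ∃ t ∈ F, x ∈ t) :
    ∀ b, Twin (proj a F) x b → b = x := by
  intro b hb
  by_cases hba : b = a
  · rw [hba] at hb
    obtain ⟨t, ht, hxt⟩ := hin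
    have h := hb (t.erase a) (mem_proj.2 ⟨t, ht, rfl⟩)
    rw [mem_erase, mem_erase] at h
    exact absurd rfl (h.1 ⟨hxa, hxt⟩).1
  · apply htw
    intro t ht
    have h := hb (t.erase a) (mem_proj.2 ⟨t, ht, rfl⟩)
    rw [mem_erase, mem_erase] at h
    constructor
    · intro hxt
      exact (h.1 ⟨hxa, hxt⟩).2
    · intro hbt
      exact (h.2 ⟨hba, hbt⟩).2

end Projection

section PairFibres

/-- **Fibres of the projection along a pair, on the members.** If the only subsets of a nonempty
set `A` among the differences of `F` are `∅` and `A`, then `|F| ≤ |{t \ A}| + |K'|` with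
`K' = {v ∈ F : v ∩ A = ∅, v ∪ A ∈ F}`: two distinct members with the same image under `t ↦ t \ A`
form a diagonal pair `{v, v ∪ A}`. -/
theorem card_le_card_image_sdiff_add_card_diag (F : Finset (Finset α)) {A : Finset α}
    (hA : A.Nonempty) (hsubA : ∀ d ∈ F \\ F, d ⊆ A → d = ∅ ∨ d = A) :
    F.card ≤ (F.image fun t => t \ A).card +
      (F.filter fun v => Disjoint v A ∧ v ∪ A ∈ F).card := by
  obtain ⟨r, hrA⟩ := hA
  have hsplit := card_filter_add_card_filter_not (s := F) (fun t => A ⊆ t ∧ t \ A ∈ F)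
  have h2 : (F.filter fun t => A ⊆ t ∧ t \ A ∈ F).card =
      (F.filter fun v => Disjoint v A ∧ v ∪ A ∈ F).card := by
    have hinj : Set.InjOn (fun t : Finset α => t \ A)
        ((F.filter fun t => A ⊆ t ∧ t \ A ∈ F) : Set (Finset α)) := by
      intro t ht t' ht' htt'
      simp only [coe_filter, Set.mem_setOf_eq] at ht ht'
      have htt'' : t \ A = t' \ A := htt'
      rw [← sdiff_union_of_subset ht.2.1, ← sdiff_union_of_subset ht'.2.1, htt'']
    rw [← card_image_of_injOn hinj]
    congr 1
    ext v
    simp only [mem_image, mem_filter]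
    constructor
    · rintro ⟨t, ⟨ht, hAt, htA⟩, rfl⟩
      refine ⟨htA, sdiff_disjoint, ?_⟩
      rw [sdiff_union_of_subset hAt]
      exact ht
    · rintro ⟨hv, hvA, hvA'⟩
      refine ⟨v ∪ A, ⟨hvA', subset_union_right, ?_⟩, ?_⟩
      · rw [union_sdiff_cancel_right hvA]
        exact hv
      · exact union_sdiff_cancel_right hvA
  have h1 : (F.filter fun t => ¬ (A ⊆ t ∧ t \ A ∈ F)).card ≤ (F.image fun t => t \ A).card := by
    apply card_le_card_of_injOn (fun t => t \ A)
    · intro t ht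
      rw [mem_coe, mem_filter] at ht
      exact mem_image_of_mem _ ht.1
    · intro t ht t' ht' htt'
      simp only [coe_filter, Set.mem_setOf_eq] at ht ht'
      have htt'' : t \ A = t' \ A := htt'
      by_contra hne
      have hsub1 : t \ t' ⊆ A := by
        intro x hx
        rw [mem_sdiff] at hx
        by_contra hxA
        have h : x ∈ t \ A := mem_sdiff.2 ⟨hx.1, hxA⟩
        rw [htt''] at h
        exact hx.2 (mem_sdiff.1 h).1
      have hsub2 : t' \ t ⊆ A := by
        intro x hx
        rw [mem_sdiff] at hx
        by_contra hxA
        have h : x ∈ t' \ A := mem_sdiff.2 ⟨hx.1, hxA⟩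
        rw [← htt''] at h
        exact hx.2 (mem_sdiff.1 h).1
      have hd1 := hsubA (t \ t') (sdiff_mem_diffs ht.1 ht'.1) hsub1
      have hd2 := hsubA (t' \ t) (sdiff_mem_diffs ht'.1 ht.1) hsub2
      rcases hd1 with h1 | h1 <;> rcases hd2 with h2 | h2
      · exact hne (Subset.antisymm (sdiff_eq_empty_iff_subset.1 h1)
          (sdiff_eq_empty_iff_subset.1 h2))
      · apply ht'.2
        refine ⟨?_, ?_⟩
        · rw [← h2]
          exact sdiff_subset
        · have h3 : t' \ A = t := by
            rw [← h2, Finset.sdiff_sdiff_eq_self (sdiff_eq_empty_iff_subset.1 h1)]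
          rw [h3]
          exact ht.1
      · apply ht.2
        refine ⟨?_, ?_⟩
        · rw [← h1]
          exact sdiff_subset
        · have h3 : t \ A = t' := by
            rw [← h1, Finset.sdiff_sdiff_eq_self (sdiff_eq_empty_iff_subset.1 h2)]
          rw [h3]
          exact ht'.1
      · have hr1 : r ∈ t \ t' := by
          rw [h1]
          exact hrA
        have hr2 : r ∈ t' \ t := by
          rw [h2]
          exact hrA
        exact (mem_sdiff.1 hr1).2 (mem_sdiff.1 hr2).1
  omega

/-- **Fibres of the projection along a pair, on the differences.** Let `r ≠ r'` lie in `A`, and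
let `u` be a set such that for every `a ∈ u \ A` the pairs `{a, r}` and `{a, r'}` are differences
of `F` but the singleton `{a}` is not. Then `|{d \ A}| + |K' \\ K'| + |u \ A| ≤ |F \\ F|` with
`K' = {v ∈ F : v ∩ A = ∅, v ∪ A ∈ F}`: the fibre of a difference `e` of `K'` contains `e` and
`e ∪ A`, the fibre of `{a}` contains `{a, r}` and `{a, r'}`. -/
theorem card_image_sdiff_add_card_diffs_diag_add_card_le (F : Finset (Finset α)) {A : Finset α}
    {r r' : α} (hrA : r ∈ A) (hr'A : r' ∈ A) (hrr' : r ≠ r') (u : Finset α)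
    (hpr : ∀ a ∈ u \ A, insert a ({r} : Finset α) ∈ F \\ F)
    (hpr' : ∀ a ∈ u \ A, insert a ({r'} : Finset α) ∈ F \\ F)
    (hsing : ∀ a ∈ u \ A, ({a} : Finset α) ∉ F \\ F) :
    ((F \\ F).image fun d => d \ A).card +
      ((F.filter fun v => Disjoint v A ∧ v ∪ A ∈ F) \\
        (F.filter fun v => Disjoint v A ∧ v ∪ A ∈ F)).card +
      (u \ A).card ≤ (F \\ F).card := by
  set K' : Finset (Finset α) := F.filter fun v => Disjoint v A ∧ v ∪ A ∈ F with hK'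
  set DQ : Finset (Finset α) := (F \\ F).image fun d => d \ A with hDQ
  set E : Finset (Finset α) := (K' \\ K') ∪ (u \ A).image (fun a => ({a} : Finset α)) with hE
  have hK'F : K' ⊆ F := filter_subset _ _
  have hDK : K' \\ K' ⊆ F \\ F := diffs_subset hK'F hK'F
  have hdisj : Disjoint (K' \\ K') ((u \ A).image fun a => ({a} : Finset α)) := by
    rw [disjoint_left]
    intro d hd hd'
    obtain ⟨a, ha, rfl⟩ := mem_image.1 hd'
    exact hsing a ha (hDK hd)
  have hEcard : E.card = (K' \\ K').card + (u \ A).card := by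
    rw [hE, card_union_of_disjoint hdisj, card_image_of_injective _ singleton_injective]
  -- every fibre over `E` has at least two elements
  have hfib : ∀ e ∈ E, 2 ≤ ((F \\ F).filter fun d => d \ A = e).card := by
    intro e he
    rw [hE, mem_union] at he
    rcases he with he | he
    · obtain ⟨v, hv, w, hw, rfl⟩ := mem_diffs.1 he
      rw [hK', mem_filter] at hv hw
      have hvA : Disjoint v A := hv.2.1
      have hwA : Disjoint w A := hw.2.1
      have hvwA : Disjoint (v \ w) A := disjoint_of_subset_left sdiff_subset hvA
      have h1 : v \ w ∈ (F \\ F).filter fun d => d \ A = v \ w := by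
        refine mem_filter.2 ⟨sdiff_mem_diffs hv.1 hw.1, ?_⟩
        exact sdiff_eq_self_iff_disjoint.2 hvwA
      have h2 : (v \ w) ∪ A ∈ (F \\ F).filter fun d => d \ A = v \ w := by
        refine mem_filter.2 ⟨?_, ?_⟩
        · have h : (v ∪ A) \ w = (v \ w) ∪ A := by
            ext x
            simp only [mem_sdiff, mem_union]
            constructor
            · rintro ⟨hx | hx, hxw⟩
              · exact Or.inl ⟨hx, hxw⟩
              · exact Or.inr hx
            · rintro (⟨hx, hxw⟩ | hx)
              · exact ⟨Or.inl hx, hxw⟩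
              · exact ⟨Or.inr hx, fun hxw => disjoint_left.1 hwA hxw hx⟩
          rw [← h]
          exact sdiff_mem_diffs hv.2.2 hw.1
        · exact union_sdiff_cancel_right hvwA
      have hne : v \ w ≠ (v \ w) ∪ A := by
        intro h
        have h' : r ∈ v \ w := by
          rw [h]
          exact mem_union_right _ hrA
        exact disjoint_left.1 hvwA h' hrA
      exact one_lt_card.2 ⟨_, h1, _, h2, hne⟩
    · obtain ⟨a, ha, rfl⟩ := mem_image.1 he
      have ha' := mem_sdiff.1 ha
      have h1 : insert a ({r} : Finset α) ∈ (F \\ F).filter fun d => d \ A = {a} := by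
        refine mem_filter.2 ⟨hpr a ha, ?_⟩
        ext x
        simp only [mem_sdiff, mem_insert, mem_singleton]
        constructor
        · rintro ⟨rfl | rfl, hxA⟩
          · rfl
          · exact absurd hrA hxA
        · rintro rfl
          exact ⟨Or.inl rfl, ha'.2⟩
      have h2 : insert a ({r'} : Finset α) ∈ (F \\ F).filter fun d => d \ A = {a} := by
        refine mem_filter.2 ⟨hpr' a ha, ?_⟩
        ext x
        simp only [mem_sdiff, mem_insert, mem_singleton]
        constructor
        · rintro ⟨rfl | rfl, hxA⟩
          · rfl
          · exact absurd hr'A hxA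
        · rintro rfl
          exact ⟨Or.inl rfl, ha'.2⟩
      have hne : insert a ({r} : Finset α) ≠ insert a ({r'} : Finset α) := by
        intro h
        have h' : r ∈ insert a ({r'} : Finset α) := by
          rw [← h]
          exact mem_insert_of_mem (mem_singleton_self r)
        rw [mem_insert, mem_singleton] at h'
        rcases h' with h' | h'
        · exact ha'.2 (h' ▸ hrA)
        · exact hrr' h'
      exact one_lt_card.2 ⟨_, h1, _, h2, hne⟩
  have hEsub : E ⊆ DQ := by
    intro e he
    have h := hfib e he
    have hpos : 0 < ((F \\ F).filter fun d => d \ A = e).card := by omega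
    obtain ⟨d, hd⟩ := card_pos.1 hpos
    rw [mem_filter] at hd
    rw [hDQ, mem_image]
    exact ⟨d, hd.1, hd.2⟩
  have hsum : (F \\ F).card = ∑ e ∈ DQ, ((F \\ F).filter fun d => d \ A = e).card :=
    card_eq_sum_card_image _ _
  have hsplit := sum_sdiff (f := fun e => ((F \\ F).filter fun d => d \ A = e).card) hEsub
  have hlow1 : (DQ \ E).card • 1 ≤ ∑ e ∈ DQ \ E, ((F \\ F).filter fun d => d \ A = e).card := by
    apply card_nsmul_le_sum
    intro e he
    have he' : e ∈ DQ := (mem_sdiff.1 he).1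
    rw [hDQ, mem_image] at he'
    obtain ⟨d, hd, rfl⟩ := he'
    exact card_pos.2 ⟨d, mem_filter.2 ⟨hd, rfl⟩⟩
  have hlow2 : E.card • 2 ≤ ∑ e ∈ E, ((F \\ F).filter fun d => d \ A = e).card :=
    card_nsmul_le_sum _ _ _ hfib
  have hcardsd : (DQ \ E).card = DQ.card - E.card := card_sdiff_of_subset hEsub
  have hle : E.card ≤ DQ.card := card_le_card hEsub
  simp only [smul_eq_mul, mul_one] at hlow1 hlow2
  omega

end PairFibres

end PercRepro.MSTight
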